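import Summits.QuantumFields.BalabanUV.T4Continuum.Support.B13TermParamGaussianBi
import Summits.QuantumFields.BalabanUV.T4Continuum.Support.B13TermContours

/-!
# B13TermContourCore — row O1-d2-ii «act instance» of the NE5 crux O1, part 5: the (2.14)-core WITH ITS CONCRETE CONTOURS — part 3's
# parameter space `(Jc ⊕ 𝒴) → ℝ × ℝ` (cubes on the circle `e^{κ₁}`, polymers on their (2.18) circles), its finite measure `lamJ`, its
# Cauchy weight `wJ (radii κ₁ r)` and the contour values `τ(Y)(p)` ON the circles, assembled into part 2's `BiCore`; the weight letter
# of the owner's shape becomes the EXPLICIT product `w₀ = (Π_Δ (2π)⁻¹((e^{κ₁} − 1)²)⁻¹e^{κ₁})·(Π_Y (2π)⁻¹((r Y − 1)²)⁻¹ r Y)` and the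
# read-out letter `N₁ = Σ_Y r Y·level136 (d (dom Y))` (cell `pub-balaban`, T⁴ fan-out,
# `HOME/t4/b2b-balaban-t4-ne5-p1/O1-CLAIM-TABLE-NE5-P1.md` row O1-d2-ii; design v0.5 R18 (a)+(b))

Unit `b2b-balaban-t4-ne5-formalise-leaf-08` (NE5 formalisation swarm, leaf prover 08, gen 2; filed gen 3).  Summits-side NEW WORK under the LEAN
PLACEMENT RULE (cell modelling + bookkeeping; nothing of the manuscripts under audit is asserted; 0 cite tags).  HONEST FRAMING: rung
(B)+1 of the FINITE-VOLUME T⁴ continuum programme — NOT infinite volume, NOT a mass gap, NOT the Clay problem, NOT a proof of NE5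
(`T4OutputRate.NE5` is NOT PRINTED and NOT PROVED; spine 0/9, unchanged).  HONEST DEPENDENCY (cell line, verbatim): continuum YM on T⁴ ⇐
BetaPertH ∧ nine spine estimates (0/9 proved); BetaPertH ⇐ (D1) ∧ (D4) ∧ CAP+tail; G-an2-4 gates asym, D1 and NE2/3/4.

WHAT THIS MODULE IS.
* §1 `ofContours` — the constructor: given the cube index `Jc`, the polymer family `𝒴` (= the `𝐃` of the term, at carrier domains `dom`),
  the letters `κ₁ > 0` and radii `r Y > 1`, the operator LETTERS `N`, `q` (functions of the full contour parameter `p`, through which they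
  read the interpolation values `sJ p` and the cube contour values `sigmaJ _ p (inl Δ)`), the χ-constraints and the field maps, the core
  `ofContours … : BiCore P dom Op ((Jc ⊕ 𝒴) → ℝ × ℝ) V` with `lam := lamJ`, `w := wJ (radii κ₁ r)`, `wB := wBJ (radii κ₁ r)`,
  `τ p Y := sigmaJ (radii κ₁ r) p (inr Y)` (ON the circle: `‖τ p Y‖ = r Y`), `rad := r`, `D := univ`.
* §2 its letters: `wB_ofContours` (the explicit product, `B13TermContours.wBJ_radii`), `N₁_ofContours` (`Σ_Y r Y·level136 (d (dom Y))`),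
  `norm_τ_ofContours` (`‖τ p Y‖ = r Y` exactly), and `termGaussianParamBi_ofContours` — part 2's headline for families of such cores, with
  the weight letter now READ OFF the radii.

STATUS (census, Edison rule).  Dictionary∕bookkeeping: of R18 (b)'s letters, `F = 1`, `N₁` and now `w₀` are theorems of the concrete core
(given `κ₁ > 0`, `r Y > 1` — the (1.22)∕(2.18) letters of the instancer, values not asserted); `N₀`, the margin letters and the mass budget
remain displayed; the Gaussian data `N`, `q` are LETTERS.  No estimate of [II]; NE5 NOT PROVED; 0/12 leaves on Bałaban's concrete objects;
spine 0/9; rung (B)+1 finite T⁴; NOT infinite volume ∕ mass gap ∕ Clay.  0 sorry; axioms ⊆ {propext, Classical.choice, Quot.sound}.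
-/

noncomputable section

open scoped BigOperators
open Set Metric MeasureTheory Finset

namespace Summit.QuantumFields.BalabanUV.T4Continuum.B13TermContourCore

open Literature.MathematicalPhysics.QuantumFieldTheory.Balaban1983to89
open Literature.MathematicalPhysics.QuantumFieldTheory.Balaban1983to89.T4OutputRate (Carriers)
open Summit.QuantumFields.BalabanUV.T4Continuum.B13HistDatum (level136)
open Summit.QuantumFields.BalabanUV.T4Continuum.B13HistMeasurable (MeasPotFrame B13HistM)
open Summit.QuantumFields.BalabanUV.T4Continuum.B13TermParamGaussianBi
open Summit.QuantumFields.BalabanUV.T4Continuum.B13TermContours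
open Summit.QuantumFields.BalabanUV.T4Continuum.OutputRateGaussianParamBi (TermGaussianParamBi)

variable {C : Carriers} (P : MeasPotFrame C) {𝒴 : Type*} (dom : 𝒴 → C.Dom)

/-! ## §1 The core with its concrete contours -/

section Core

variable {Op V : Type*} [NormedAddCommGroup V] [InnerProductSpace ℝ V] [MeasurableSpace V] (Jc : Type*) [Fintype Jc] [Fintype 𝒴]

/-- **THE (2.14)-CORE WITH ITS CONCRETE CONTOURS**: parameter space `(Jc ⊕ 𝒴) → ℝ × ℝ` (one `(t, θ)` per cube `Δ ∈ Jc` and per polymer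
`Y ∈ 𝒴`), measure `lamJ`, weight `wJ (radii κ₁ r)` bounded by `wBJ (radii κ₁ r)` (radii `e^{κ₁} > 1`, `r Y > 1`), contour weights
`τ(Y)(p) = sigmaJ _ p (inr Y)` ON the circle of radius `r Y`, polymer family ALL of `𝒴`; the operator letters `N`, `q`, the χ-constraints
and the field maps are the caller's. [folklore] -/
def ofContours {κ₁ : ℝ} (hκ : 0 < κ₁) {r : 𝒴 → ℝ} (hr : ∀ Y, 1 < r Y) (N : Op → ((Jc ⊕ 𝒴) → ℝ × ℝ) → ℂ)
    (q : Op → ((Jc ⊕ 𝒴) → ℝ × ℝ) → V → ℂ) (cons : List ((V →L[ℝ] ℝ) × ℝ × Bool)) (nsign : ℕ)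
    (B : (Y : 𝒴) → V → P.Arg (dom Y)) (measB : ∀ Y, Measurable (B Y)) : BiCore P dom Op ((Jc ⊕ 𝒴) → ℝ × ℝ) V where
  lam := lamJ (Jc ⊕ 𝒴)
  finite := inferInstance
  w := wJ (radii κ₁ r)
  measW := measurable_wJ _
  wB := wBJ (radii (Jc := Jc) κ₁ r)
  norm_w_le := norm_wJ_radii_le hκ hr
  N := N
  q := q
  cons := cons
  nsign := nsign
  D := Finset.univ
  τ p Y := sigmaJ (radii κ₁ r) p (Sum.inr Y)
  measτ Y := measurable_sigmaJ _ _
  rad := r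
  rad_nonneg Y := zero_le_one.trans (hr Y).le
  norm_τ_le p Y := by
    have h := norm_sigmaJ_le (radii_nonneg hκ hr) p (Sum.inr Y)
    rwa [radii_inr] at h
  B := B
  measB := measB

variable {P dom Jc}
variable {κ₁ : ℝ} (hκ : 0 < κ₁) {r : 𝒴 → ℝ} (hr : ∀ Y, 1 < r Y) (N : Op → ((Jc ⊕ 𝒴) → ℝ × ℝ) → ℂ)
  (q : Op → ((Jc ⊕ 𝒴) → ℝ × ℝ) → V → ℂ) (cons : List ((V →L[ℝ] ℝ) × ℝ × Bool)) (nsign : ℕ)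
  (B : (Y : 𝒴) → V → P.Arg (dom Y)) (measB : ∀ Y, Measurable (B Y))

/-! ## §2 Its letters -/

/-- [folklore] **THE WEIGHT LETTER, EXPLICITLY**: `wB = (Π_Δ (2π)⁻¹((e^{κ₁} − 1)²)⁻¹e^{κ₁})·(Π_Y (2π)⁻¹((r Y − 1)²)⁻¹ r Y)`. -/
theorem wB_ofContours : (ofContours P dom Jc hκ hr N q cons nsign B measB).wB =
    (∏ _Δ : Jc, wB₁ (Real.exp κ₁)) * ∏ Y : 𝒴, wB₁ (r Y) :=
  wBJ_radii κ₁ r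

/-- [folklore] The parameter measure is part 3's product measure (finite). -/
theorem lam_ofContours : (ofContours P dom Jc hκ hr N q cons nsign B measB).lam = lamJ (Jc ⊕ 𝒴) := rfl

/-- [folklore] The weight is part 3's product Cauchy weight at the (2.14) radii. -/
theorem w_ofContours : (ofContours P dom Jc hκ hr N q cons nsign B measB).w = wJ (radii κ₁ r) := rfl

/-- [folklore] **THE CONTOUR WEIGHTS LIVE ON THE CIRCLES**: `‖τ p Y‖ = r Y` exactly (not only `≤`). -/
theorem norm_τ_ofContours (p : (Jc ⊕ 𝒴) → ℝ × ℝ) (Y : 𝒴) : ‖(ofContours P dom Jc hκ hr N q cons nsign B measB).τ p Y‖ = r Y := by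
  have h := norm_sigmaJ (radii_nonneg hκ hr) p (Sum.inr Y)
  rwa [radii_inr] at h

/-- [folklore] **THE READ-OUT LETTER, EXPLICITLY**: `N₁ = Σ_Y r Y·level136 (d (dom Y))` over the whole polymer family. -/
theorem N₁_ofContours : (ofContours P dom Jc hκ hr N q cons nsign B measB).N₁ = ∑ Y : 𝒴, r Y * level136 P.consts (C.d (dom Y)) :=
  rfl

end Core

/-! ## §3 The shape of record for families of contour cores: the weight letter read off the radii -/

section Shape

variable {P dom}
variable {Op : Type*} [NormedAddCommGroup Op] [NormedSpace ℂ Op] {ι : Type*} (Jc : ℕ → ι → Type*) [∀ k i, Fintype (Jc k i)]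
  [Fintype 𝒴] {α : ℕ → ι → Type*} [∀ k i, NormedAddCommGroup (α k i)] [∀ k i, InnerProductSpace ℝ (α k i)]
  [∀ k i, FiniteDimensional ℝ (α k i)] [∀ k i, MeasurableSpace (α k i)] [∀ k i, BorelSpace (α k i)]

/-- **THE SHAPE OF RECORD FOR CONTOUR CORES** — part 2's `termGaussianParamBi_termBi` for a family built by `ofContours` (per `(k, i, X)`:
cube index `Jc k i`, letters `κ₁ k i X > 0`, radii `r k i X Y > 1`, operator letters, constraints, field maps): the SAME conclusion with
the weight letter now the EXPLICIT `wBJ (radii (κ₁ k i X) (r k i X))`, `F = 1`, `N₁ = Σ_Y r k i X Y·level136 (d (dom Y))`; the operator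
letters displayed as in part 2. [folklore] -/
theorem termGaussianParamBi_ofContours {W : Set (ℕ → ℝ)} {ctr : ℕ → (ℕ → ℝ) → C.BgB → Op × B13HistM P} {RHist R' : ℕ → ℝ}
    {κ₁ : ℕ → ι → C.Dom → ℝ} (hκ : ∀ k i X, 0 < κ₁ k i X) {r : ℕ → ι → C.Dom → 𝒴 → ℝ} (hr : ∀ k i X Y, 1 < r k i X Y)
    (N : ∀ k i, C.Dom → Op → ((Jc k i ⊕ 𝒴) → ℝ × ℝ) → ℂ) (q : ∀ k i, C.Dom → Op → ((Jc k i ⊕ 𝒴) → ℝ × ℝ) → α k i → ℂ)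
    (cons : ∀ k i, C.Dom → List ((α k i →L[ℝ] ℝ) × ℝ × Bool)) (nsign : ℕ → ι → C.Dom → ℕ)
    (B : ∀ k i, C.Dom → (Y : 𝒴) → α k i → P.Arg (dom Y)) (measB : ∀ k i X Y, Measurable (B k i X Y))
    {m b N₀ : ℕ → ι → C.Dom → ℝ}
    (hm : ∀ k, ∀ g ∈ W, ∀ (U : C.BgB) (X : C.Dom), C.scale X = k → ∀ i, 0 < m k i X)
    (hN : ∀ k, ∀ g ∈ W, ∀ (U : C.BgB) (X : C.Dom), C.scale X = k → ∀ i,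
      (∀ o ∈ ball (ctr k g U).1 (R' k), AEStronglyMeasurable (N k i X o) (lamJ (Jc k i ⊕ 𝒴))) ∧
      (∀ p, DifferentiableOn ℂ (fun o => N k i X o p) (ball (ctr k g U).1 (R' k))) ∧
      (∀ o ∈ ball (ctr k g U).1 (R' k), ∀ p, ‖N k i X o p‖ ≤ N₀ k i X))
    (hq : ∀ k, ∀ g ∈ W, ∀ (U : C.BgB) (X : C.Dom), C.scale X = k → ∀ i,
      (∀ o ∈ ball (ctr k g U).1 (R' k), AEStronglyMeasurable (Function.uncurry (q k i X o)) ((lamJ (Jc k i ⊕ 𝒴)).prod volume)) ∧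
      (∀ p v, DifferentiableOn ℂ (fun o => q k i X o p v) (ball (ctr k g U).1 (R' k))) ∧
      (∀ o ∈ ball (ctr k g U).1 (R' k), ∀ p v, m k i X * ‖v‖ ^ 2 - b k i X ≤ (q k i X o p v).re)) :
    let 𝔊 : ∀ k i, C.Dom → BiCore P dom Op ((Jc k i ⊕ 𝒴) → ℝ × ℝ) (α k i) := fun k i X =>
      ofContours P dom (Jc k i) (hκ k i X) (hr k i X) (N k i X) (q k i X) (cons k i X) (nsign k i X) (B k i X) (measB k i X)
    TermGaussianParamBi (termBi 𝔊) W ctr RHist R' (fun k i _ => lamJ (Jc k i ⊕ 𝒴)) (fun k i X => wJ (radii (κ₁ k i X) (r k i X)))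
      (fun k i X => N k i X) (fun k i X _ v => (𝔊 k i X).chi v) (fun k i X => (𝔊 k i X).readOut) (fun k i X => q k i X) m b
      (fun k i X => wBJ (radii (Jc := Jc k i) (κ₁ k i X) (r k i X))) N₀ (fun _ _ _ => 1)
      fun k i X => ∑ Y : 𝒴, r k i X Y * level136 P.consts (C.d (dom Y)) := by
  intro 𝔊
  exact termGaussianParamBi_termBi 𝔊 hm hN hq

end Shape

end Summit.QuantumFields.BalabanUV.T4Continuum.B13TermContourCore

end
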